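import Mathlib
import Summits.MatrixMultiplication.Statement
import Summits.MatrixMultiplication.MatrixMultiplication.Theorems.GraphEquationsSystems
import Summits.MatrixMultiplication.MatrixMultiplication.Theorems.GraphEquationsKernel
import Summits.MatrixMultiplication.MatrixMultiplication.Theorems.GraphEquationsCostRank

/-!
# `CoeffIdentity` holds: the reduced branch of `GraphEquations` is a theorem (`GraphEquations`, 5/4)

Decomp-mm node `N5²³` «GraphEquations».  Module 4/4 (`GraphEquationsCostRank`) brought the
cost–rank inequality for generically reduced correct equation systems for the graph
`W_n = {C = AB}` — and with it the reduced-systems branch `H_red` of the route — down to ONE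
named commutative-algebra statement `CoeffIdentity`:

  for `t ∈ ℂ[A,B,C]` vanishing on `W_n` and all `i j j' l`,
  `coeff_{a_ij b_j'l}(t) = −[j = j'] · coeff_{c_il}(t)`.

This module PROVES it (`coeffIdentity`), by a two-parameter probe of the graph: the curve family
`(A, B, C) = (s·E_ij, u·E_j'l, [j = j']·s u·E_il)` lies on `W_n`, so `t` composed with it is a
polynomial in `s, u` vanishing on `ℂ²`, hence zero (`MvPolynomial.funext`); its `s u`-coefficient
is `coeff_{a_ij b_j'l}(t) + [j = j']·coeff_{c_il}(t)` (only the monomials `a_ij b_j'l` and `c_il`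
of `t` reach `s u`).  Consequences, all by the kernels of module 4/4:

* `reducedSystemsCostRankCost_holds : ReducedSystemsCostRankCost` — a correct system for `W_n`
  generically reduced at some point of the graph with `N` product gates gives
  `R(⟨n,n,n⟩) ≤ 2N` (Strassen's truncation at a reduced point + `(14.8)`
  (sources: BurgisserClausenShokrollahi1997, Prop. (14.1), (14.8)));
* `reducedEquationsForceMultiplication_holds : ReducedEquationsForceMultiplication` (`H_red`);
* `equationsForceMultiplication_of_multiplicityReduction : MultiplicityReduction → H` and
  `matrixMultiplication_of_quadratic_of_multiplicityReduction : V → H_mult → ω = 2` —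
  the route `GraphEquations` modulo exactly its two OPEN pieces `V` (existence of
  `O(n^{2+ε})` equation systems) and `H_mult` (multiplicity reduction).

No new definitions; theorems only.
-/

set_option linter.dupNamespace false

open scoped BigOperators

namespace Summit.MatrixMultiplication.MatrixMultiplication.Theorems.GraphEquations

open MvPolynomial
open Literature.Computability.AlgebraicComplexity
open Literature.Computability.AlgebraicComplexity.ArithCircuit

/-! ## The two-parameter probe: coefficient bookkeeping

Generic lemmas over a variable type `σ` with three distinguished variables `a, b, c` and a
substitution `f` into `ℂ[s, u] = MvPolynomial (Fin 2) ℂ` with `f a = s`, `f b = u`,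
`f c = κ·s u` and `f v = 0` otherwise. -/

section Probe

variable {σ : Type*} [DecidableEq σ]

omit [DecidableEq σ] in
/-- Three distinct points determine `single a α + single b β + single c γ`. -/
theorem probe_single₃_eq_iff {a b c : σ} (hab : a ≠ b) (hac : a ≠ c) (hbc : b ≠ c)
    (α β γ α' β' γ' : ℕ) :
    Finsupp.single a α + Finsupp.single b β + Finsupp.single c γ =
        Finsupp.single a α' + Finsupp.single b β' + Finsupp.single c γ' ↔
      α = α' ∧ β = β' ∧ γ = γ' := by
  constructor
  · intro h
    have h1 := DFunLike.congr_fun h a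
    have h2 := DFunLike.congr_fun h b
    have h3 := DFunLike.congr_fun h c
    simp [hab, hac, hbc, hab.symm, hac.symm, hbc.symm] at h1 h2 h3
    exact ⟨h1, h2, h3⟩
  · rintro ⟨rfl, rfl, rfl⟩; rfl

/-- Coefficient of `s u` in `r · s^{e₀} u^{e₁}`. -/
theorem probe_coeff_monomial (e₀ e₁ : ℕ) (r : ℂ) :
    MvPolynomial.coeff (Finsupp.single (0 : Fin 2) 1 + Finsupp.single 1 1)
        (MvPolynomial.monomial (Finsupp.single (0 : Fin 2) e₀ + Finsupp.single 1 e₁) r) =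
      if e₀ = 1 ∧ e₁ = 1 then r else 0 := by
  rw [MvPolynomial.coeff_monomial]
  by_cases h : e₀ = 1 ∧ e₁ = 1
  · rcases h with ⟨rfl, rfl⟩; simp
  · rw [if_neg h, if_neg]
    intro heq
    apply h
    have h0 := DFunLike.congr_fun heq 0
    have h1 := DFunLike.congr_fun heq 1
    simp at h0 h1
    exact ⟨h0, h1⟩

/-- **Coefficient of `s u` after the probe substitution, on a monomial**: only `r·a b` (giving `r`)
and `r·c` (giving `κ r`) reach `s u`. -/
theorem probe_coeff_bind₁_monomial (f : σ → MvPolynomial (Fin 2) ℂ) (a b c : σ) (κ : ℂ)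
    (hab : a ≠ b) (hac : a ≠ c) (hbc : b ≠ c)
    (hfa : f a = X 0) (hfb : f b = X 1) (hfc : f c = C κ * (X 0 * X 1))
    (hf0 : ∀ v, v ≠ a → v ≠ b → v ≠ c → f v = 0) (m : σ →₀ ℕ) (r : ℂ) :
    MvPolynomial.coeff (Finsupp.single (0 : Fin 2) 1 + Finsupp.single 1 1)
        (MvPolynomial.bind₁ f (MvPolynomial.monomial m r)) =
      (if m = Finsupp.single a 1 + Finsupp.single b 1 then r else 0) +
        κ * (if m = Finsupp.single c 1 then r else 0) := by
  by_cases hsupp : ∃ v ∈ m.support, v ≠ a ∧ v ≠ b ∧ v ≠ c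
  · -- a killed variable occurs in `m`: everything vanishes
    obtain ⟨v, hv, hva, hvb, hvc⟩ := hsupp
    have hmv : m v ≠ 0 := Finsupp.mem_support_iff.mp hv
    have hprod : ∏ i ∈ m.support, f i ^ m i = 0 :=
      Finset.prod_eq_zero hv (by rw [hf0 v hva hvb hvc, zero_pow hmv])
    have h1 : m ≠ Finsupp.single a 1 + Finsupp.single b 1 := by
      intro h; apply hmv; rw [h]; simp [Ne.symm hva, Ne.symm hvb]
    have h2 : m ≠ Finsupp.single c 1 := by
      intro h; apply hmv; rw [h]; simp [Ne.symm hvc]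
    rw [MvPolynomial.bind₁_monomial, hprod, mul_zero, MvPolynomial.coeff_zero, if_neg h1, if_neg h2]
    ring
  · push Not at hsupp
    -- `m` is supported on `{a, b, c}`: name its three exponents
    obtain ⟨α, β, γ, rfl⟩ :
        ∃ α β γ : ℕ, m = Finsupp.single a α + Finsupp.single b β + Finsupp.single c γ := by
      refine ⟨m a, m b, m c, ?_⟩
      ext v
      simp only [Finsupp.coe_add, Pi.add_apply, Finsupp.single_apply]
      by_cases h1 : a = v
      · subst h1; simp [Ne.symm hab, Ne.symm hac]
      by_cases h2 : b = v
      · subst h2; simp [h1, Ne.symm hbc]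
      by_cases h3 : c = v
      · subst h3; simp [h1, h2]
      simp only [h1, h2, h3, if_false, add_zero]
      exact Finsupp.notMem_support_iff.mp fun hv =>
        h3 (hsupp v hv (fun h => h1 h.symm) (fun h => h2 h.symm)).symm
    have hmono : (MvPolynomial.monomial (Finsupp.single a α + Finsupp.single b β +
          Finsupp.single c γ) r : MvPolynomial σ ℂ) = C r * (X a ^ α * X b ^ β * X c ^ γ) := by
      simp only [X_pow_eq_monomial, monomial_mul, C_mul_monomial, mul_one]
    have hlhs : (C r * (X 0 ^ α * X 1 ^ β * (C κ * (X 0 * X 1)) ^ γ) : MvPolynomial (Fin 2) ℂ) =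
        MvPolynomial.monomial (Finsupp.single 0 (α + γ) + Finsupp.single 1 (β + γ))
          (r * κ ^ γ) := by
      rw [mul_pow, mul_pow, ← C_pow,
        show (Finsupp.single (0 : Fin 2) (α + γ) + Finsupp.single 1 (β + γ)) =
            Finsupp.single 0 α + Finsupp.single 1 β +
              (Finsupp.single 0 γ + Finsupp.single 1 γ) from by
          simp only [Finsupp.single_add]; abel]
      simp only [X_pow_eq_monomial, monomial_mul, C_mul_monomial, mul_one, one_mul]
    rw [hmono, map_mul, bind₁_C_right, map_mul, map_mul, map_pow, map_pow, map_pow, bind₁_X_right,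
      bind₁_X_right, bind₁_X_right, hfa, hfb, hfc, hlhs, probe_coeff_monomial,
      show Finsupp.single a 1 + Finsupp.single b 1 =
          Finsupp.single a 1 + Finsupp.single b 1 + Finsupp.single c 0 from by simp,
      show (Finsupp.single c 1 : σ →₀ ℕ) =
          Finsupp.single a 0 + Finsupp.single b 0 + Finsupp.single c 1 from by simp]
    simp only [probe_single₃_eq_iff hab hac hbc]
    obtain rfl | rfl | hγ : γ = 0 ∨ γ = 1 ∨ 2 ≤ γ := by omega
    · simp
    · simp only [pow_one, Nat.add_eq_right, one_ne_zero, and_false, if_false, zero_add, and_true]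
      split_ifs <;> ring
    · have hA : ¬(α + γ = 1 ∧ β + γ = 1) := by omega
      have hB : ¬(α = 1 ∧ β = 1 ∧ γ = 0) := by omega
      have hC : ¬(α = 0 ∧ β = 0 ∧ γ = 1) := by omega
      simp [hA, hB, hC]

/-- **Coefficient of `s u` after the probe substitution**:
`coeff_{su}(t ∘ probe) = coeff_{ab}(t) + κ · coeff_c(t)`. -/
theorem probe_coeff_bind₁ (f : σ → MvPolynomial (Fin 2) ℂ) (a b c : σ) (κ : ℂ)
    (hab : a ≠ b) (hac : a ≠ c) (hbc : b ≠ c)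
    (hfa : f a = X 0) (hfb : f b = X 1) (hfc : f c = C κ * (X 0 * X 1))
    (hf0 : ∀ v, v ≠ a → v ≠ b → v ≠ c → f v = 0) (t : MvPolynomial σ ℂ) :
    MvPolynomial.coeff (Finsupp.single (0 : Fin 2) 1 + Finsupp.single 1 1)
        (MvPolynomial.bind₁ f t) =
      MvPolynomial.coeff (Finsupp.single a 1 + Finsupp.single b 1) t +
        κ * MvPolynomial.coeff (Finsupp.single c 1) t := by
  induction t using MvPolynomial.induction_on' with
  | monomial m r =>
    rw [probe_coeff_bind₁_monomial f a b c κ hab hac hbc hfa hfb hfc hf0,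
      MvPolynomial.coeff_monomial, MvPolynomial.coeff_monomial]
  | add p q hp hq => simp only [map_add, MvPolynomial.coeff_add, hp, hq]; ring

omit [DecidableEq σ] in
/-- Evaluating a substituted polynomial = evaluating at the evaluated substitution. -/
theorem probe_eval_bind₁ (f : σ → MvPolynomial (Fin 2) ℂ) (y : Fin 2 → ℂ)
    (t : MvPolynomial σ ℂ) :
    MvPolynomial.eval y (MvPolynomial.bind₁ f t) =
      MvPolynomial.eval (fun v => MvPolynomial.eval y (f v)) t :=
  MvPolynomial.eval₂Hom_bind₁ _ _ _ _

end Probe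

/-! ## The identity -/

/-- **`CoeffIdentity` (BCS-style coefficient comparison on the graph `W_n`).**  For
`t ∈ ℂ[A,B,C]` vanishing on `W_n = {C = AB}` and all `i j j' l`:
`coeff_{a_ij b_j'l}(t) = −[j = j'] · coeff_{c_il}(t)`.  Proof: probe the graph with
`(s·E_ij, u·E_j'l, [j = j']·s u·E_il)` and read off the `s u`-coefficient. -/
theorem coeffIdentity : CoeffIdentity := by
  classical
  intro n t ht i j j' l
  -- the probe substitution
  set f : GraphVars n → MvPolynomial (Fin 2) ℂ := fun v =>
    if v = Sum.inl (Sum.inl (i, j)) then X 0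
    else if v = Sum.inl (Sum.inr (j', l)) then X 1
    else if v = Sum.inr (i, l) then C (if j = j' then (1 : ℂ) else 0) * (X 0 * X 1)
    else 0 with hf
  have hab : (Sum.inl (Sum.inl (i, j)) : GraphVars n) ≠ Sum.inl (Sum.inr (j', l)) := by simp
  have hac : (Sum.inl (Sum.inl (i, j)) : GraphVars n) ≠ Sum.inr (i, l) := Sum.inl_ne_inr
  have hbc : (Sum.inl (Sum.inr (j', l)) : GraphVars n) ≠ Sum.inr (i, l) := Sum.inl_ne_inr
  have hfa : f (Sum.inl (Sum.inl (i, j))) = X 0 := by simp [hf]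
  have hfb : f (Sum.inl (Sum.inr (j', l))) = X 1 := by simp [hf]
  have hfc : f (Sum.inr (i, l)) = C (if j = j' then (1 : ℂ) else 0) * (X 0 * X 1) := by
    simp [hf]
  have hf0 : ∀ v : GraphVars n, v ≠ Sum.inl (Sum.inl (i, j)) → v ≠ Sum.inl (Sum.inr (j', l)) →
      v ≠ Sum.inr (i, l) → f v = 0 := by
    intro v h1 h2 h3; simp [hf, h1, h2, h3]
  -- every value of the probe is a point of the graph
  have hmem : ∀ y : Fin 2 → ℂ, (fun v => MvPolynomial.eval y (f v)) ∈ mmGraph n := by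
    intro y p q
    by_cases hp : p = i
    · subst hp
      by_cases hq : q = l
      · subst hq
        rcases eq_or_ne j j' with rfl | hne
        · simp [hf, apply_ite (MvPolynomial.eval y), ite_mul, Finset.sum_ite_eq']
        · simp [hf, hne, hne.symm, apply_ite (MvPolynomial.eval y), ite_mul, Finset.sum_ite_eq']
      · simp [hf, hq, apply_ite (MvPolynomial.eval y)]
    · simp [hf, hp, apply_ite (MvPolynomial.eval y)]
  -- hence `t ∘ probe` vanishes on `ℂ²`, so it is the zero polynomial
  have hzero : MvPolynomial.bind₁ f t = 0 := by
    apply MvPolynomial.funext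
    intro y
    rw [map_zero, probe_eval_bind₁]
    exact ht _ (hmem y)
  -- read off the `s u`-coefficient
  have hcoeff := probe_coeff_bind₁ f _ _ _ (if j = j' then (1 : ℂ) else 0) hab hac hbc hfa hfb hfc
    hf0 t
  rw [hzero, MvPolynomial.coeff_zero] at hcoeff
  by_cases hjj : j = j'
  · simp only [hjj, if_true] at hcoeff ⊢
    linear_combination -hcoeff
  · simp only [hjj, if_false] at hcoeff ⊢
    linear_combination -hcoeff

/-! ## Consequences: the reduced branch closes -/

/-- `H_red♭₀` holds: correct systems reduced at the origin cost `≥ R(⟨n,n,n⟩)/2` products. -/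
theorem reducedSystemsCostRankZero_holds : ReducedSystemsCostRankZero :=
  costRankZero_of_coeffIdentity coeffIdentity

/-- **`H_red♭` holds**: a correct equation system for `W_n`, generically reduced (at some point of
the graph), with `N` product gates gives `R(⟨n,n,n⟩) ≤ 2N`
(sources: BurgisserClausenShokrollahi1997, Prop. (14.1), (14.8)). -/
theorem reducedSystemsCostRankCost_holds : ReducedSystemsCostRankCost :=
  costRankCost_of_coeffIdentity coeffIdentity

/-- **`H_red` holds**: generically reduced `O(n^β)` families of correct systems force `ω ≤ β`. -/
theorem reducedEquationsForceMultiplication_holds : ReducedEquationsForceMultiplication :=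
  reducedForce_of_coeffIdentity coeffIdentity

/-- `H_mult → H`: the attacked crux of `GraphEquations` reduces to multiplicity reduction alone. -/
theorem equationsForceMultiplication_of_multiplicityReduction (hmult : MultiplicityReduction) :
    EquationsForceMultiplication :=
  forceMultiplication_of_coeffIdentity coeffIdentity hmult

/-- **The route modulo exactly its two open pieces**: `V → H_mult → ω = 2`. -/
theorem matrixMultiplication_of_quadratic_of_multiplicityReduction (hV : GraphEquationsQuadratic)
    (hmult : MultiplicityReduction) : _root_.MatrixMultiplication :=
  matrixMultiplication_of_coeffIdentity hV coeffIdentity hmult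

end Summit.MatrixMultiplication.MatrixMultiplication.Theorems.GraphEquations
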